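import Literature.Analysis.FluidPDE.MVIdentitiesAveraged
import HarnessLib

/-!
# The relative-energy inequality for a dissipative measure-valued solution (BF (3.5))

Březina–Feireisl 2018, §3.1.1: testing the continuity identity with `φ₁ = ½|u|² - μ(ρ,ϑ)`, the
momentum identity with `u`, the entropy inequality with `ϑ > 0` and a cut-off `Z`, adding the
energy balance and `∫ p(r,Θ)`, one obtains for a.e. `τ ∈ (0,T)`

`∫⟨Y_{τ,x}; ℰ_Z(d(τ,x))⟩ dx + D(τ) ≤ ∫_{(0,τ)×𝕋³} ⟨Y_z; rawRHS_Z(d_z)⟩ dz + M · massUpTo(τ)`,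

where `rawRHS` is the integrand of `MVRelativeEnergyPointwise.lean`, `M` bounds `∇ₓu`, and the
last term is the concentration pairing `|∫∇ₓu : dμ_R| ≤ M‖μ_R‖([0,τ)×𝕋³)` (BF (2.29)); the initial
terms vanish for Dirac initial data (`initial_terms_eq_zero`). This is `relEnergy_inequality`.

## References

* J. Březina, E. Feireisl, J. Math. Soc. Japan 70 (2018), (3.4)–(3.5).
-/

noncomputable section

open Set Function MeasureTheory ProbabilityTheory Filter
open scoped BigOperators ENNReal Topology InnerProductSpace

namespace Literature.Analysis.FluidPDE

namespace CompressibleEuler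

open Literature.Analysis.FunctionSpaces EulerPhase StrongPointData EulerEOS
open Literature.Analysis.FunctionSpaces.Torus hiding kineticEnergy

variable {eos : EulerEOS} {T T₁ : ℝ} {ρ : ℝ → UnitAddTorus (Fin 3) → ℝ}
  {u : ℝ → UnitAddTorus (Fin 3) → EuclideanSpace ℝ (Fin 3)} {ϑ : ℝ → UnitAddTorus (Fin 3) → ℝ}
  {Y : Kernel (ℝ × UnitAddTorus (Fin 3)) EulerPhase} {D : ℝ → ℝ}

/-- **The averaged right-hand side splits**: for a.e. `τ`,
`∫_{(0,τ)×𝕋³}⟨Y; rawRHS_Z(d)⟩ = -∫⟨Y;momI⟩ + ∫⟨Y;contI⟩ - ∫⟨Y;entI_Z⟩ + ∫∂ₜp(r,Θ)`, all four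
space–time integrands being integrable on `(0,T) × 𝕋³`. [cite: BrezinaFeireisl2018, (3.5)] -/
theorem rawRHS_spacetime_split (hG : eos.IsGibbs) (hS : eos.IsThermodynamicallyStable)
    (htemp : ∀ r E : ℝ, 0 < r → 0 < E →
      0 < eos.temperature r E ∧ r * eos.e r (eos.temperature r E) = E)
    (h : IsClassicalEulerSolution eos T₁ ρ u ϑ) (hTT₁ : T < T₁)
    (hMV : IsDissipativeMVSolution eos.toConservative T Y D)
    (hsupp : ∀ z, ∀ᵐ w ∂(Y z), w ∈ phaseQuadrant) {Z : ℝ → ℝ} (hZ : IsEntropyCutoff Z)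
    {M : ℝ} (hB : ∀ t ∈ Icc (0 : ℝ) T, ∀ x, (pdAt T₁ ρ u ϑ (t, x)).Bounded M)
    {N : ℝ} (hN : CoeffBound eos T₁ ρ u ϑ T N) {τ : ℝ} (hτ : τ ∈ Ioo 0 T) :
    IntegrableOn (fun z => ∫ w, rawRHS eos Z (pdAt T₁ ρ u ϑ z) (dens w) (ien w) (mom w) ∂(Y z))
      (Ioo 0 T ×ˢ univ) volume ∧
    ∫ z in Ioo 0 τ ×ˢ univ, ∫ w, rawRHS eos Z (pdAt T₁ ρ u ϑ z) (dens w) (ien w) (mom w) ∂(Y z) =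
      -(∫ z in Ioo 0 τ ×ˢ univ, ∫ w, (pdAt T₁ ρ u ϑ z).momI eos w ∂(Y z)) +
        (∫ z in Ioo 0 τ ×ˢ univ, ∫ w, (pdAt T₁ ρ u ϑ z).contI eos w ∂(Y z)) -
        (∫ z in Ioo 0 τ ×ˢ univ, ∫ w, (pdAt T₁ ρ u ϑ z).entI eos Z w ∂(Y z)) +
        ∫ z in Ioo 0 τ ×ˢ univ, (pdAt T₁ ρ u ϑ z).pt eos := by
  haveI := hMV.markov
  obtain ⟨Zb, hZb⟩ := hZ.2.2
  have hZc : Continuous Z := hZ.1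
  have hZb0 : 0 ≤ Zb := (abs_nonneg _).trans (hZb 0)
  have hM0 : 0 ≤ M := (abs_nonneg _).trans (hB 0 ⟨le_rfl, hτ.1.le.trans hτ.2.le⟩ 0).1
  have hN0 : 0 ≤ N := (abs_nonneg _).trans (hN 0 ⟨le_rfl, hτ.1.le.trans hτ.2.le⟩ 0).2.1
  obtain ⟨ccont, cmom, cent, -, craw, -, -⟩ := h.continuousOn_integrands hG hS htemp hZc
  obtain ⟨-, -, cpt, -⟩ := h.continuousOn_coeffs hG
  have memT : ∀ z ∈ Ioo (0 : ℝ) T ×ˢ (univ : Set (UnitAddTorus (Fin 3))), z.1 ∈ Icc (0 : ℝ) T :=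
    fun z hz => ⟨hz.1.1.le, hz.1.2.le⟩
  -- space–time integrability of the four pieces and of the raw right-hand side
  have iM := spacetime_integrable hG hS htemp hMV hsupp hTT₁.le cmom (A := 12 * M) (B := 0) (by positivity) le_rfl
    fun z hz w hw => by rw [add_zero]; exact abs_momI_le hw (hB z.1 (memT z hz) z.2)
  have iC := spacetime_integrable hG hS htemp hMV hsupp hTT₁.le ccont (A := 4 * N) (B := 0) (by positivity) le_rfl
    fun z hz w hw => by
      rw [add_zero]; exact abs_contI_le hw (hN z.1 (memT z hz) z.2).2.2.2.2.1 (hN z.1 (memT z hz) z.2).2.2.2.2.2.1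
  have iE := spacetime_integrable hG hS htemp hMV hsupp hTT₁.le cent (A := 4 * Zb * M) (B := 0) (by positivity)
    le_rfl fun z hz w hw => by rw [add_zero]; exact abs_entI_le hw (hB z.1 (memT z hz) z.2) hZb
  have iP := spacetime_integrable hG hS htemp hMV hsupp hTT₁.le (liftZ cpt) (A := 0) (B := N) le_rfl hN0
    fun z hz w _ => by rw [zero_mul, zero_add]; exact (hN z.1 (memT z hz) z.2).2.2.2.1
  have iR := spacetime_integrable hG hS htemp hMV hsupp hTT₁.le craw (A := 12 * M + 4 * N + 4 * Zb * M) (B := N)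
    (by positivity) hN0 fun z hz w hw =>
      abs_rawRHS_le hw (hB z.1 (memT z hz) z.2) hZb (hN z.1 (memT z hz) z.2).2.2.2.2.1
        (hN z.1 (memT z hz) z.2).2.2.2.2.2.1 (hN z.1 (memT z hz) z.2).2.2.2.1
  refine ⟨iR.2, ?_⟩
  -- pointwise (a.e. `z`) splitting of the bracket
  have hmeasS : MeasurableSet (Ioo (0 : ℝ) T ×ˢ (univ : Set (UnitAddTorus (Fin 3)))) :=
    measurableSet_Ioo.prod MeasurableSet.univ
  have hsub : Ioo (0 : ℝ) τ ×ˢ (univ : Set (UnitAddTorus (Fin 3))) ⊆ Ioo 0 T ×ˢ univ :=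
    prod_mono (Ioo_subset_Ioo_right hτ.2.le) subset_rfl
  have hae : ∀ᵐ z ∂((volume : Measure (ℝ × UnitAddTorus (Fin 3))).restrict (Ioo 0 T ×ˢ univ)),
      ∫ w, rawRHS eos Z (pdAt T₁ ρ u ϑ z) (dens w) (ien w) (mom w) ∂(Y z) =
        -(∫ w, (pdAt T₁ ρ u ϑ z).momI eos w ∂(Y z)) + (∫ w, (pdAt T₁ ρ u ϑ z).contI eos w ∂(Y z)) -
          (∫ w, (pdAt T₁ ρ u ϑ z).entI eos Z w ∂(Y z)) + (pdAt T₁ ρ u ϑ z).pt eos := by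
    filter_upwards [iM.1, iC.1, iE.1] with z hm hc he
    haveI : IsProbabilityMeasure (Y z) := IsMarkovKernel.isProbabilityMeasure z
    have s1 : ∫ w, (-(pdAt T₁ ρ u ϑ z).momI eos w + (pdAt T₁ ρ u ϑ z).contI eos w) ∂(Y z) =
        (∫ w, -(pdAt T₁ ρ u ϑ z).momI eos w ∂(Y z)) + ∫ w, (pdAt T₁ ρ u ϑ z).contI eos w ∂(Y z) :=
      integral_add hm.neg hc
    have s2 : ∫ w, ((-(pdAt T₁ ρ u ϑ z).momI eos w + (pdAt T₁ ρ u ϑ z).contI eos w) -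
        (pdAt T₁ ρ u ϑ z).entI eos Z w) ∂(Y z) =
        (∫ w, (-(pdAt T₁ ρ u ϑ z).momI eos w + (pdAt T₁ ρ u ϑ z).contI eos w) ∂(Y z)) -
          ∫ w, (pdAt T₁ ρ u ϑ z).entI eos Z w ∂(Y z) := integral_sub (hm.neg.add hc) he
    have s3 : ∫ w, (((-(pdAt T₁ ρ u ϑ z).momI eos w + (pdAt T₁ ρ u ϑ z).contI eos w) -
        (pdAt T₁ ρ u ϑ z).entI eos Z w) + (pdAt T₁ ρ u ϑ z).pt eos) ∂(Y z) =
        (∫ w, ((-(pdAt T₁ ρ u ϑ z).momI eos w + (pdAt T₁ ρ u ϑ z).contI eos w) -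
          (pdAt T₁ ρ u ϑ z).entI eos Z w) ∂(Y z)) + ∫ _w, (pdAt T₁ ρ u ϑ z).pt eos ∂(Y z) :=
      integral_add ((hm.neg.add hc).sub he) (integrable_const _)
    have s4 : ∫ _w : EulerPhase, (pdAt T₁ ρ u ϑ z).pt eos ∂(Y z) = (pdAt T₁ ρ u ϑ z).pt eos := by
      simp [integral_const]
    rw [← integral_neg, ← s1, ← s2, ← s4, ← s3]
    refine integral_congr_ae (Eventually.of_forall fun w => ?_)
    beta_reduce
    rw [rawRHS_eq_pieces]
  -- integrate over `(0,τ) × 𝕋³`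
  have hae' : ∀ᵐ z ∂(volume : Measure (ℝ × UnitAddTorus (Fin 3))), z ∈ Ioo (0 : ℝ) τ ×ˢ univ →
      ∫ w, rawRHS eos Z (pdAt T₁ ρ u ϑ z) (dens w) (ien w) (mom w) ∂(Y z) =
        -(∫ w, (pdAt T₁ ρ u ϑ z).momI eos w ∂(Y z)) + (∫ w, (pdAt T₁ ρ u ϑ z).contI eos w ∂(Y z)) -
          (∫ w, (pdAt T₁ ρ u ϑ z).entI eos Z w ∂(Y z)) + (pdAt T₁ ρ u ϑ z).pt eos := by
    rw [ae_restrict_iff' hmeasS] at hae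
    filter_upwards [hae] with z hz hzτ
    exact hz (hsub hzτ)
  rw [setIntegral_congr_ae (measurableSet_Ioo.prod MeasurableSet.univ) hae']
  have jM : IntegrableOn (fun z => ∫ w, (pdAt T₁ ρ u ϑ z).momI eos w ∂(Y z)) (Ioo 0 τ ×ˢ univ) volume :=
    IntegrableOn.mono_set (μ := volume) (t := Ioo 0 T ×ˢ univ) iM.2 hsub
  have jC : IntegrableOn (fun z => ∫ w, (pdAt T₁ ρ u ϑ z).contI eos w ∂(Y z)) (Ioo 0 τ ×ˢ univ) volume :=
    IntegrableOn.mono_set (μ := volume) (t := Ioo 0 T ×ˢ univ) iC.2 hsub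
  have jE : IntegrableOn (fun z => ∫ w, (pdAt T₁ ρ u ϑ z).entI eos Z w ∂(Y z)) (Ioo 0 τ ×ˢ univ) volume :=
    IntegrableOn.mono_set (μ := volume) (t := Ioo 0 T ×ˢ univ) iE.2 hsub
  have jP : IntegrableOn (fun z => (pdAt T₁ ρ u ϑ z).pt eos) (Ioo 0 τ ×ˢ univ) volume := by
    have hP : IntegrableOn (fun z => ∫ _w, (pdAt T₁ ρ u ϑ z).pt eos ∂(Y z)) (Ioo 0 τ ×ˢ univ) volume :=
      IntegrableOn.mono_set (μ := volume) (t := Ioo 0 T ×ˢ univ) iP.2 hsub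
    haveI : ∀ z, IsProbabilityMeasure (Y z) := fun z => IsMarkovKernel.isProbabilityMeasure z
    refine hP.congr_fun (fun z _ => ?_) (measurableSet_Ioo.prod MeasurableSet.univ)
    simp [integral_const]
  rw [integral_add ((jM.fun_neg.fun_add jC).sub' jE) jP, integral_sub (jM.fun_neg.fun_add jC) jE,
    integral_add jM.fun_neg jC, integral_neg]

/-- **The relative-energy inequality (BF (3.5))** for a dissipative measure-valued solution
carried by the open quadrant, with Dirac initial data given by the strong solution: for a.e.
`τ ∈ (0,T)`,
`∫⟨Y_{τ,x}; ℰ_Z(d(τ,x))⟩ dx + D(τ) ≤ ∫_{(0,τ)×𝕋³}⟨Y_z; rawRHS_Z(d_z)⟩ dz + M·massUpTo(τ)`,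
together with the compatibility bound `massUpTo(τ) ≤ c ∫₀^τ D` of the concentration measure.
[cite: BrezinaFeireisl2018, (3.4)–(3.5)] -/
theorem relEnergy_inequality (hG : eos.IsGibbs) (hS : eos.IsThermodynamicallyStable)
    (htemp : ∀ r E : ℝ, 0 < r → 0 < E →
      0 < eos.temperature r E ∧ r * eos.e r (eos.temperature r E) = E)
    (h : IsClassicalEulerSolution eos T₁ ρ u ϑ) (hT : 0 < T) (hTT₁ : T < T₁)
    (hMV : IsDissipativeMVSolution eos.toConservative T Y D)
    (hsupp : ∀ z, ∀ᵐ w ∂(Y z), w ∈ phaseQuadrant)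
    (hY0 : ∀ᵐ x ∂(volume : Measure (UnitAddTorus (Fin 3))),
      Y (0, x) = Measure.dirac (classicalState eos ρ u ϑ 0 x))
    {Z : ℝ → ℝ} (hZ : IsEntropyCutoff Z) (hZs : ∀ x, Z (eos.s (ρ 0 x) (ϑ 0 x)) = eos.s (ρ 0 x) (ϑ 0 x))
    {M : ℝ} (hB : ∀ t ∈ Icc (0 : ℝ) T, ∀ x, (pdAt T₁ ρ u ϑ (t, x)).Bounded M)
    {N : ℝ} (hN : CoeffBound eos T₁ ρ u ϑ T N) :
    ∃ μR : ConcentrationMeasure, ∃ c : ℝ,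
      (∀ᵐ τ ∂(volume.restrict (Ioo 0 T)), μR.massUpTo τ ≤ ENNReal.ofReal (c * ∫ t in Ioo 0 τ, D t)) ∧
      ∀ᵐ τ ∂(volume.restrict (Ioo 0 T)),
        (∫ x, ∫ w, (pdAt T₁ ρ u ϑ (τ, x)).relEnergyZ eos Z w ∂(Y (τ, x))) + D τ ≤
          (∫ z in Ioo 0 τ ×ˢ univ, ∫ w, rawRHS eos Z (pdAt T₁ ρ u ϑ z) (dens w) (ien w) (mom w) ∂(Y z)) +
            M * (μR.massUpTo τ).toReal := by
  haveI := hMV.markov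
  obtain ⟨Ψ⟩ := nonempty_testTriple h hG hT hTT₁
  obtain ⟨μR, c, hmomid, hmass⟩ := hMV.momentum
  obtain ⟨C, hC, hmomb⟩ := hMV.moment_bound
  have h1 := cont_identity_avg hG hS htemp h hMV hsupp Ψ
  have h2 := mom_identity_avg hG hS htemp hMV hsupp Ψ hmomid
  have h3 := ent_inequality_avg hG hS htemp h hMV hsupp Ψ hTT₁ hZ
  have h4 := hMV.energy
  have hinit := initial_terms_eq_zero h hG (hT.trans hTT₁) hY0 hZ.1 hZs Ψ hT.le
  refine ⟨μR, c, hmass, ?_⟩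
  filter_upwards [h1, h2, h3, h4, hmomb, ae_restrict_mem measurableSet_Ioo] with τ e1 e2 e3 e4 e5 hτ
  have hτ₁ : τ ∈ Ioo 0 T₁ := ⟨hτ.1, hτ.2.trans hTT₁⟩
  have hτT : τ ∈ Icc 0 T := ⟨hτ.1.le, hτ.2.le⟩
  have hτ' : τ ∈ Icc 0 Ψ.T' := ⟨hτ.1.le, (hτ.2.trans Ψ.hT).le⟩
  -- the slice at `τ`
  obtain ⟨-, -, -, -, -, -, hslice⟩ := relEnergyZ_slice_eq hG hS htemp h hsupp hτ₁ hC e5 hZ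
    (fun x => hB τ hτT x) (N := N) fun x => ⟨(hN τ hτT x).1, (hN τ hτT x).2.1, (hN τ hτT x).2.2.1⟩
  -- the test functions at time `τ`
  simp only [Ψ.eq₁ τ hτ', Ψ.eq₂ τ hτ', Ψ.eq₃ τ hτ'] at e1 e2 e3
  -- the pressure
  have hp := pressure_ftc h hG hτ₁ (N := N) fun t ht x => (hN t ⟨ht.1, ht.2.trans hτ.2.le⟩ x).2.2.2.1
  -- the right-hand side
  obtain ⟨-, hsplit⟩ := rawRHS_spacetime_split hG hS htemp h hTT₁ hMV hsupp hZ hB hN hτ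
  -- the concentration pairing
  have hpg : |μR.pairGrad τ Ψ.ψ₂| ≤ M * (μR.massUpTo τ).toReal := by
    refine abs_pairGrad_le μR fun z hz i j => ?_
    have hz' : z.1 ∈ Icc 0 Ψ.T' := ⟨hz.1.1, (hz.1.2.le.trans hτ.2.le).trans Ψ.hT.le⟩
    rw [(Ψ.partialDeriv_ψ₂ hz' z.2 i j).1]
    exact (hB z.1 ⟨hz.1.1, hz.1.2.le.trans hτ.2.le⟩ z.2).2.2.2.2.2.2 i j
  have hpg' := (abs_le.1 hpg).1
  rw [hslice, hsplit]
  linarith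

end CompressibleEuler

end Literature.Analysis.FluidPDE

/-!
# Tools for the conclusion of the weak–strong uniqueness argument (BF §3.2.2, end)

* `eq_classicalState_of_relEnergyFull_eq_zero` — strict coercivity: `ℰ(ρ,E,m | r,Θ,U) = 0` on the
  open quadrant forces `(ρ, E, m) = (r, r e(r,Θ), rU)` (BF (3.8) with `K = {(r,Θ)}`);
* `eq_dirac_of_ae_eq` — a probability measure a.e. equal to a point is the Dirac mass;
* `ae_restrict_prod_of_ae_ae_entropy_ge` — the iterated-a.e. entropy minimum principle in
  product-a.e. form on `(0,T) × 𝕋³` (measurability of `{z | Y_z{s < a} = 0}`);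
* `IsClassicalEulerSolution.exists_coeffBound` — the uniform coefficient bounds `CoeffBound` on
  `[0,T] × 𝕋³` from compactness of the thermodynamic range and the derivative bound `M`.

## References

* J. Březina, E. Feireisl, J. Math. Soc. Japan 70 (2018), §3.2.2.
-/

noncomputable section

open Set Function MeasureTheory ProbabilityTheory Filter
open scoped BigOperators ENNReal Topology InnerProductSpace

namespace Literature.Analysis.FluidPDE

namespace CompressibleEuler

open Literature.Analysis.FunctionSpaces EulerPhase StrongPointData EulerEOS
open Literature.Analysis.FunctionSpaces.Torus hiding kineticEnergy

variable {eos : EulerEOS}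

/-! ## Strict coercivity of the relative energy -/

/-- `relEnergyThermo(r,Θ; ρ,ϑ) = 0` with all arguments positive forces `(ρ,ϑ) = (r,Θ)`
(uniform coercivity with `K = {(r,Θ)}`). [cite: BrezinaFeireisl2018, (3.8)] -/
theorem eq_of_relEnergyThermo_eq_zero (hG : eos.IsGibbs) (hS : eos.IsThermodynamicallyStable)
    {r Θ ρ ϑ : ℝ} (hr : 0 < r) (hΘ : 0 < Θ) (hρ : 0 < ρ) (hϑ : 0 < ϑ)
    (h0 : eos.relEnergyThermo r Θ ρ ϑ = 0) : ρ = r ∧ ϑ = Θ := by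
  have hK : IsCompact ({(r, Θ)} : Set (ℝ × ℝ)) := isCompact_singleton
  have hKq : ({(r, Θ)} : Set (ℝ × ℝ)) ⊆ Ioi 0 ×ˢ Ioi 0 := by
    rintro q rfl; exact ⟨hr, hΘ⟩
  obtain ⟨δ, c, hδ, hc, -, hcoer⟩ := relEnergyThermo_coercivity_near_far hG hS hK hKq
  obtain ⟨hnear, hfar⟩ := hcoer r Θ ρ ϑ rfl hρ hϑ
  by_cases h1 : |ρ - r| ≤ δ
  · by_cases h2 : |ϑ - Θ| ≤ δ
    · have := hnear h1 h2
      rw [h0] at this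
      have hsq : (ρ - r) ^ 2 + (ϑ - Θ) ^ 2 ≤ 0 := by
        by_contra hcon
        have : 0 < c * ((ρ - r) ^ 2 + (ϑ - Θ) ^ 2) := mul_pos hc (not_le.1 hcon)
        linarith
      constructor <;> nlinarith [sq_nonneg (ρ - r), sq_nonneg (ϑ - Θ)]
    · have := hfar (Or.inr (not_le.1 h2).le); rw [h0] at this; linarith
  · have := hfar (Or.inl (not_le.1 h1).le); rw [h0] at this; linarith

/-- **Strict coercivity**: on the open quadrant, `ℰ(ρ,E,m | d) = 0` forces the state to be the
classical state `(r, r e(r,Θ), rU)` of the point data. [cite: BrezinaFeireisl2018, (3.8), §3.2.2] -/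
theorem eq_classicalState_of_relEnergyFull_eq_zero (hG : eos.IsGibbs) (hS : eos.IsThermodynamicallyStable)
    (d : StrongPointData) (hr : 0 < d.r) (hΘ : 0 < d.Θ) {w : EulerPhase} (hw : w ∈ phaseQuadrant)
    (hϑ : 0 < stateTemp eos (dens w) (ien w))
    (hE : dens w * eos.e (dens w) (stateTemp eos (dens w) (ien w)) = ien w)
    (h0 : relEnergyFull eos d (dens w) (ien w) (mom w) = 0) :
    w = (d.r, d.r * eos.e d.r d.Θ, d.r • d.U) := by
  have hkin : 0 ≤ (∑ i, (mom w i - dens w * d.U i) ^ 2) / (2 * dens w) := by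
    have := hw.1; positivity
  have hth : 0 ≤ eos.relEnergyThermo d.r d.Θ (dens w) (stateTemp eos (dens w) (ien w)) :=
    relEnergyThermo_nonneg hG hS hr hΘ hw.1 hϑ
  have hsum : (∑ i, (mom w i - dens w * d.U i) ^ 2) / (2 * dens w) +
      eos.relEnergyThermo d.r d.Θ (dens w) (stateTemp eos (dens w) (ien w)) = 0 := h0
  have hth0 : eos.relEnergyThermo d.r d.Θ (dens w) (stateTemp eos (dens w) (ien w)) = 0 := by linarith
  have hkin0 : (∑ i, (mom w i - dens w * d.U i) ^ 2) / (2 * dens w) = 0 := by linarith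
  obtain ⟨hρr, hϑΘ⟩ := eq_of_relEnergyThermo_eq_zero hG hS hr hΘ hw.1 hϑ hth0
  have hsq : ∑ i, (mom w i - dens w * d.U i) ^ 2 = 0 := by
    have h2 : (0 : ℝ) < 2 * dens w := by have := hw.1; positivity
    rwa [div_eq_zero_iff, or_iff_left h2.ne'] at hkin0
  have hmi : ∀ i, mom w i = dens w * d.U i := by
    intro i
    have := (Finset.sum_eq_zero_iff_of_nonneg fun j _ => sq_nonneg (mom w j - dens w * d.U j)).1 hsq i
      (Finset.mem_univ i)
    nlinarith [sq_nonneg (mom w i - dens w * d.U i)]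
  have hmom : mom w = d.r • d.U := by
    ext i; rw [PiLp.smul_apply, smul_eq_mul, hmi i, hρr]
  have hien : ien w = d.r * eos.e d.r d.Θ := by rw [← hE, hϑΘ, hρr]
  obtain ⟨ρw, Ew, mw⟩ := w
  simp only [dens, ien, mom] at hρr hien hmom
  simp [hρr, hien, hmom]

/-- The relative energy `w ↦ ℰ(w | d)` is continuous on the open quadrant (fixed point data).
[folklore] -/
theorem continuousOn_relEnergyFull_fibre (hG : eos.IsGibbs) (hS : eos.IsThermodynamicallyStable)
    (htemp : ∀ r E : ℝ, 0 < r → 0 < E →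
      0 < eos.temperature r E ∧ r * eos.e r (eos.temperature r E) = E) (d : StrongPointData) :
    ContinuousOn (fun w : EulerPhase => relEnergyFull eos d (dens w) (ien w) (mom w)) phaseQuadrant := by
  have wPair := continuousOn_dens_stateTemp hG hS htemp
  have we : ContinuousOn (fun w : EulerPhase => eos.e (dens w) (stateTemp eos (dens w) (ien w))) phaseQuadrant :=
    hG.2.1.continuousOn.comp wPair.1 wPair.2
  have wS := continuousOn_stateEntropy hG hS htemp
  have wD : Continuous (dens : EulerPhase → ℝ) := continuous_dens
  have wM : ∀ i, Continuous fun w : EulerPhase => mom w i := fun i =>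
    (EuclideanSpace.proj i : EuclideanSpace ℝ (Fin 3) →L[ℝ] ℝ).continuous.comp continuous_mom
  have hA : ContinuousOn (fun w : EulerPhase => (∑ i, (mom w i - dens w * d.U i) ^ 2) / (2 * dens w))
      phaseQuadrant :=
    (continuousOn_finsetSum _ fun i _ => (((wM i).sub (wD.mul continuous_const)).pow 2).continuousOn).div
      (continuous_const.mul wD).continuousOn fun w hw => mul_ne_zero two_ne_zero (hw.1).ne'
  have hB : ContinuousOn (fun w : EulerPhase =>
      dens w * eos.e (dens w) (stateTemp eos (dens w) (ien w)) -
        d.Θ * (dens w * eos.s (dens w) (stateTemp eos (dens w) (ien w)))) phaseQuadrant :=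
    (wD.continuousOn.mul we).sub (continuousOn_const.mul (wD.continuousOn.mul wS))
  have hC : ContinuousOn (fun w : EulerPhase => eos.chemPotential d.r d.Θ * (dens w - d.r)) phaseQuadrant :=
    continuousOn_const.mul (wD.continuousOn.sub continuousOn_const)
  simp only [relEnergyFull, EulerEOS.relEnergyThermo, EulerEOS.ballisticFreeEnergy]
  exact hA.add ((hB.sub hC).sub continuousOn_const)

/-! ## Dirac masses -/

/-- A probability measure a.e. concentrated at a point is the Dirac mass. [folklore] -/
theorem eq_dirac_of_ae_eq {α : Type*} [MeasurableSpace α] [MeasurableSingletonClass α]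
    {μ : Measure α} [IsProbabilityMeasure μ] {a : α} (h : ∀ᵐ x ∂μ, x = a) : μ = Measure.dirac a := by
  have hnull : μ {x | x ≠ a} = 0 := by
    rw [ae_iff] at h; simpa using h
  ext s hs
  rw [Measure.dirac_apply' _ hs]
  by_cases ha : a ∈ s
  · rw [indicator_of_mem ha, Pi.one_apply]
    have hsub : sᶜ ⊆ {x | x ≠ a} := fun x hx hxa => hx (by rw [hxa]; exact ha)
    have h1 : μ sᶜ = 0 := measure_mono_null hsub hnull
    have := prob_add_prob_compl (μ := μ) hs
    rw [h1, add_zero] at this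
    exact this
  · rw [indicator_of_notMem ha]
    have hsub : s ⊆ {x | x ≠ a} := fun x hx hxa => ha (by rw [← hxa]; exact hx)
    exact measure_mono_null hsub hnull

/-! ## Product-a.e. form of the entropy minimum principle -/

variable {T T₁ : ℝ} {ρ : ℝ → UnitAddTorus (Fin 3) → ℝ}
  {u : ℝ → UnitAddTorus (Fin 3) → EuclideanSpace ℝ (Fin 3)} {ϑ : ℝ → UnitAddTorus (Fin 3) → ℝ}
  {Y : Kernel (ℝ × UnitAddTorus (Fin 3)) EulerPhase} {D : ℝ → ℝ}

/-- From `∀ᵐ τ, ∀ᵐ x, Y_{τ,x}-a.e. s ≥ a` to the product-a.e. statement on `(0,T) × 𝕋³`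
(the set `{z | Y_z{s < a} = 0}` is measurable). [folklore] -/
theorem ae_restrict_prod_of_ae_ae_entropy_ge (hG : eos.IsGibbs) (hS : eos.IsThermodynamicallyStable)
    (htemp : ∀ r E : ℝ, 0 < r → 0 < E →
      0 < eos.temperature r E ∧ r * eos.e r (eos.temperature r E) = E)
    (hsupp : ∀ z, ∀ᵐ w ∂(Y z), w ∈ phaseQuadrant) {a : ℝ}
    (h : ∀ᵐ τ ∂(volume.restrict (Ioo 0 T)), ∀ᵐ x ∂(volume : Measure (UnitAddTorus (Fin 3))),
      ∀ᵐ w ∂(Y (τ, x)), a ≤ eos.s (dens w) (stateTemp eos (dens w) (ien w))) :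
    ∀ᵐ z ∂((volume : Measure (ℝ × UnitAddTorus (Fin 3))).restrict (Ioo 0 T ×ˢ univ)),
      ∀ᵐ w ∂(Y z), a ≤ eos.s (dens w) (stateTemp eos (dens w) (ien w)) := by
  classical
  set sMod : EulerPhase → ℝ := phaseQuadrant.piecewise
    (fun w => eos.s (dens w) (stateTemp eos (dens w) (ien w))) 0 with hsMod
  have hsm : Measurable sMod :=
    measurable_piecewise_zero (continuousOn_stateEntropy hG hS htemp) measurableSet_phaseQuadrant
  set A : Set EulerPhase := phaseQuadrant ∩ {w | sMod w < a} with hA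
  have hAm : MeasurableSet A := measurableSet_phaseQuadrant.inter (measurableSet_lt hsm measurable_const)
  set B : Set (ℝ × UnitAddTorus (Fin 3)) := {z | Y z A = 0} with hB
  have hBm : MeasurableSet B := (Kernel.measurable_coe Y hAm) (measurableSet_singleton 0)
  have hiff : ∀ z, (∀ᵐ w ∂(Y z), a ≤ eos.s (dens w) (stateTemp eos (dens w) (ien w))) ↔ z ∈ B := by
    intro z
    rw [hB, mem_setOf_eq, ae_iff]
    have hQ : Y z phaseQuadrantᶜ = 0 := ae_iff.1 (hsupp z)
    have hval : ∀ w ∈ phaseQuadrant, sMod w = eos.s (dens w) (stateTemp eos (dens w) (ien w)) := fun w hw => by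
      simp [hsMod, hw]
    have : {w | ¬a ≤ eos.s (dens w) (stateTemp eos (dens w) (ien w))} =ᵐ[Y z] A := by
      refine ae_eq_set.2 ⟨measure_mono_null ?_ hQ, measure_mono_null ?_ hQ⟩
      · rintro w ⟨h1, h2⟩ hwQ
        exact h2 ⟨hwQ, by rw [mem_setOf_eq, hval w hwQ]; exact not_le.1 h1⟩
      · rintro w ⟨⟨hwQ, hlt⟩, h2⟩ _
        rw [mem_setOf_eq, hval w hwQ] at hlt
        exact h2 (not_le.2 hlt)
    rw [measure_congr this]
  have h' : ∀ᵐ τ ∂(volume.restrict (Ioo 0 T)), ∀ᵐ x ∂(volume : Measure (UnitAddTorus (Fin 3))),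
      (τ, x) ∈ B := by
    filter_upwards [h] with τ hτ
    filter_upwards [hτ] with x hx
    exact (hiff (τ, x)).1 hx
  have hprod : ∀ᵐ z ∂((volume.restrict (Ioo (0 : ℝ) T)).prod (volume : Measure (UnitAddTorus (Fin 3)))), z ∈ B :=
    (Measure.ae_prod_mem_iff_ae_ae_mem hBm).2 h'
  rw [Measure.restrict_prod_eq_prod_univ, ← Measure.volume_eq_prod] at hprod
  filter_upwards [hprod] with z hz
  exact (hiff z).2 hz

/-! ## The coefficient bounds -/

/-- **Uniform coefficient bounds** on `[0,T] × 𝕋³`, `T < T₁`, for a classical solution: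
`CoeffBound` holds with some `N` (compactness of the thermodynamic range, continuity of
`p, s, e, p_ρ, p_ϑ` on the quadrant, and the derivative bound `M`). [folklore] -/
theorem IsClassicalEulerSolution.exists_coeffBound (h : IsClassicalEulerSolution eos T₁ ρ u ϑ)
    (hG : eos.IsGibbs) (hT : 0 ≤ T) (hTT₁ : T < T₁) {M : ℝ} (hM0 : 0 ≤ M)
    (hB : ∀ t ∈ Icc (0 : ℝ) T, ∀ x, (pdAt T₁ ρ u ϑ (t, x)).Bounded M) :
    ∃ N : ℝ, CoeffBound eos T₁ ρ u ϑ T N := by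
  obtain ⟨hK, hKq⟩ := h.isCompact_range_thermo hTT₁
  -- one continuous function dominating all thermodynamic coefficients
  set Fth : ℝ × ℝ → ℝ := fun q =>
    |deriv (fun x => eos.p x q.2) q.1 / q.1| + |-eos.s q.1 q.2 + deriv (fun y => eos.p q.1 y) q.2 / q.1| +
      |deriv (fun x => eos.p x q.2) q.1| + |deriv (fun y => eos.p q.1 y) q.2| + |eos.p q.1 q.2| + |q.2| +
      |eos.chemPotential q.1 q.2| with hFth
  have hq0 : ∀ q ∈ Ioi (0 : ℝ) ×ˢ Ioi (0 : ℝ), q.1 ≠ 0 := fun q hq => (hq.1 : 0 < q.1).ne'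
  have cpρ := continuousOn_deriv_slice_fst hG.1 isOpen_quadrant le_rfl
  have cpϑ := continuousOn_deriv_slice_snd hG.1 isOpen_quadrant le_rfl
  have cs : ContinuousOn (fun q : ℝ × ℝ => eos.s q.1 q.2) (Ioi 0 ×ˢ Ioi 0) := hG.2.2.1.continuousOn
  have cp : ContinuousOn (fun q : ℝ × ℝ => eos.p q.1 q.2) (Ioi 0 ×ˢ Ioi 0) := hG.1.continuousOn
  have cμ := hG.continuousOn_chemPotential
  have hFc : ContinuousOn Fth (Ioi 0 ×ˢ Ioi 0) := by
    simp only [hFth]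
    exact ((((((cpρ.div continuousOn_fst hq0).abs.add ((cs.neg.add (cpϑ.div continuousOn_fst hq0)).abs)).add
      cpρ.abs).add cpϑ.abs).add cp.abs).add continuousOn_snd.abs).add cμ.abs
  obtain ⟨S, hS⟩ := hK.exists_bound_of_continuousOn (hFc.mono hKq)
  -- membership of `(r,Θ)(t,x)` in the range
  have hmem : ∀ t ∈ Icc (0 : ℝ) T, ∀ x,
      ((pdAt T₁ ρ u ϑ (t, x)).r, (pdAt T₁ ρ u ϑ (t, x)).Θ) ∈
        (fun z : ℝ × UnitAddTorus (Fin 3) => (ρ z.1 z.2, ϑ z.1 z.2)) '' (Icc 0 T ×ˢ univ) :=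
    fun t ht x => ⟨(t, x), ⟨ht, mem_univ _⟩, rfl⟩
  have hS0 : 0 ≤ S := by
    obtain ⟨x⟩ := (inferInstance : Nonempty (UnitAddTorus (Fin 3)))
    exact (norm_nonneg _).trans (hS _ (hmem 0 ⟨le_rfl, hT⟩ x))
  -- the seven coefficient bounds at a point
  have hFS : ∀ t ∈ Icc (0 : ℝ) T, ∀ x,
      |(pdAt T₁ ρ u ϑ (t, x)).μρ eos| ≤ S ∧ |(pdAt T₁ ρ u ϑ (t, x)).μϑ eos| ≤ S ∧
      |(pdAt T₁ ρ u ϑ (t, x)).pρ eos| ≤ S ∧ |(pdAt T₁ ρ u ϑ (t, x)).pϑ eos| ≤ S ∧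
      |eos.p (pdAt T₁ ρ u ϑ (t, x)).r (pdAt T₁ ρ u ϑ (t, x)).Θ| ≤ S ∧ |(pdAt T₁ ρ u ϑ (t, x)).Θ| ≤ S ∧
      |eos.chemPotential (pdAt T₁ ρ u ϑ (t, x)).r (pdAt T₁ ρ u ϑ (t, x)).Θ| ≤ S := by
    intro t ht x
    have hb := hS _ (hmem t ht x)
    rw [Real.norm_eq_abs, hFth] at hb
    simp only at hb
    rw [abs_of_nonneg (by positivity)] at hb
    simp only [μρ, μϑ, pρ, pϑ]
    refine ⟨?_, ?_, ?_, ?_, ?_, ?_, ?_⟩ <;>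
      linarith [abs_nonneg (deriv (fun x_1 => eos.p x_1 (pdAt T₁ ρ u ϑ (t, x)).Θ) (pdAt T₁ ρ u ϑ (t, x)).r /
          (pdAt T₁ ρ u ϑ (t, x)).r),
        abs_nonneg (-eos.s (pdAt T₁ ρ u ϑ (t, x)).r (pdAt T₁ ρ u ϑ (t, x)).Θ +
          deriv (fun y => eos.p (pdAt T₁ ρ u ϑ (t, x)).r y) (pdAt T₁ ρ u ϑ (t, x)).Θ / (pdAt T₁ ρ u ϑ (t, x)).r),
        abs_nonneg (deriv (fun x_1 => eos.p x_1 (pdAt T₁ ρ u ϑ (t, x)).Θ) (pdAt T₁ ρ u ϑ (t, x)).r),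
        abs_nonneg (deriv (fun y => eos.p (pdAt T₁ ρ u ϑ (t, x)).r y) (pdAt T₁ ρ u ϑ (t, x)).Θ),
        abs_nonneg (eos.p (pdAt T₁ ρ u ϑ (t, x)).r (pdAt T₁ ρ u ϑ (t, x)).Θ),
        abs_nonneg ((pdAt T₁ ρ u ϑ (t, x)).Θ),
        abs_nonneg (eos.chemPotential (pdAt T₁ ρ u ϑ (t, x)).r (pdAt T₁ ρ u ϑ (t, x)).Θ)]
  -- elementary sums
  have hsumUU : ∀ {U : EuclideanSpace ℝ (Fin 3)} {V : Fin 3 → ℝ}, (∀ i, |U i| ≤ M) → (∀ i, |V i| ≤ M) →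
      |∑ i, U i * V i| ≤ 3 * M ^ 2 := by
    intro U V hU hV
    calc |∑ i, U i * V i| ≤ ∑ i, |U i * V i| := Finset.abs_sum_le_sum_abs _ _
      _ ≤ ∑ _i : Fin 3, M ^ 2 := Finset.sum_le_sum fun i _ => by
          rw [abs_mul, sq]; exact mul_le_mul (hU i) (hV i) (abs_nonneg _) hM0
      _ = 3 * M ^ 2 := by simp
  have hnormU : ∀ {U : EuclideanSpace ℝ (Fin 3)}, (∀ i, |U i| ≤ M) → ‖U‖ ^ 2 ≤ 3 * M ^ 2 := by
    intro U hU
    rw [EuclideanSpace.real_norm_sq_eq]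
    calc ∑ i, U i ^ 2 ≤ ∑ _i : Fin 3, M ^ 2 := Finset.sum_le_sum fun i _ => by
          rw [← sq_abs]; exact pow_le_pow_left₀ (abs_nonneg _) (hU i) 2
      _ = 3 * M ^ 2 := by simp
  refine ⟨3 * M ^ 2 + 2 * S * M + S, fun t ht x => ?_⟩
  obtain ⟨f1, f2, f3, f4, f5, f6, f7⟩ := hFS t ht x
  have hb := hB t ht x
  obtain ⟨brt, bΘt, bU, bUt, bgr, bgΘ, bgU⟩ := hb
  have hSM : 0 ≤ S * M := mul_nonneg hS0 hM0
  have hM2 : 0 ≤ M ^ 2 := sq_nonneg M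
  have prod_le : ∀ {a b : ℝ}, |a| ≤ S → |b| ≤ M → |a * b| ≤ S * M := fun ha hb => by
    rw [abs_mul]; exact mul_le_mul ha hb (abs_nonneg _) hS0
  refine ⟨?_, ?_, ?_, ?_, ?_, ?_, ?_⟩
  · -- `|½|U|² - μ|`
    have h1 : |‖(pdAt T₁ ρ u ϑ (t, x)).U‖ ^ 2 / 2| ≤ 3 * M ^ 2 / 2 := by
      rw [abs_of_nonneg (by positivity)]; linarith [hnormU bU]
    calc _ ≤ |‖(pdAt T₁ ρ u ϑ (t, x)).U‖ ^ 2 / 2| +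
        |eos.chemPotential (pdAt T₁ ρ u ϑ (t, x)).r (pdAt T₁ ρ u ϑ (t, x)).Θ| := abs_sub _ _
      _ ≤ _ := by linarith
  · linarith
  · linarith
  · -- `|∂ₜp|`
    simp only [pt]
    calc _ ≤ |(pdAt T₁ ρ u ϑ (t, x)).pρ eos * (pdAt T₁ ρ u ϑ (t, x)).rt| +
        |(pdAt T₁ ρ u ϑ (t, x)).pϑ eos * (pdAt T₁ ρ u ϑ (t, x)).Θt| := abs_add_le _ _
      _ ≤ S * M + S * M := add_le_add (prod_le f3 brt) (prod_le f4 bΘt)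
      _ ≤ _ := by linarith
  · -- `|∂ₜφ₁|`
    simp only [φ₁t]
    have h1 := hsumUU bU bUt
    have h2 : |(pdAt T₁ ρ u ϑ (t, x)).μρ eos * (pdAt T₁ ρ u ϑ (t, x)).rt +
        (pdAt T₁ ρ u ϑ (t, x)).μϑ eos * (pdAt T₁ ρ u ϑ (t, x)).Θt| ≤ S * M + S * M :=
      (abs_add_le _ _).trans (add_le_add (prod_le f1 brt) (prod_le f2 bΘt))
    calc _ ≤ |∑ i, (pdAt T₁ ρ u ϑ (t, x)).U i * (pdAt T₁ ρ u ϑ (t, x)).Ut i| +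
        |(pdAt T₁ ρ u ϑ (t, x)).μρ eos * (pdAt T₁ ρ u ϑ (t, x)).rt +
          (pdAt T₁ ρ u ϑ (t, x)).μϑ eos * (pdAt T₁ ρ u ϑ (t, x)).Θt| := abs_sub _ _
      _ ≤ _ := by linarith
  · -- `|∂ⱼφ₁|`
    intro j
    simp only [gφ₁]
    have h1 := hsumUU bU (fun i => bgU i j)
    have h2 : |(pdAt T₁ ρ u ϑ (t, x)).μρ eos * (pdAt T₁ ρ u ϑ (t, x)).gr j +
        (pdAt T₁ ρ u ϑ (t, x)).μϑ eos * (pdAt T₁ ρ u ϑ (t, x)).gΘ j| ≤ S * M + S * M :=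
      (abs_add_le _ _).trans (add_le_add (prod_le f1 (bgr j)) (prod_le f2 (bgΘ j)))
    calc _ ≤ |∑ i, (pdAt T₁ ρ u ϑ (t, x)).U i * (pdAt T₁ ρ u ϑ (t, x)).gU i j| +
        |(pdAt T₁ ρ u ϑ (t, x)).μρ eos * (pdAt T₁ ρ u ϑ (t, x)).gr j +
          (pdAt T₁ ρ u ϑ (t, x)).μϑ eos * (pdAt T₁ ρ u ϑ (t, x)).gΘ j| := abs_sub _ _
      _ ≤ _ := by linarith
  · -- `|∂ⱼp|`
    intro j
    simp only [gp]
    calc _ ≤ |(pdAt T₁ ρ u ϑ (t, x)).pρ eos * (pdAt T₁ ρ u ϑ (t, x)).gr j| +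
        |(pdAt T₁ ρ u ϑ (t, x)).pϑ eos * (pdAt T₁ ρ u ϑ (t, x)).gΘ j| := abs_add_le _ _
      _ ≤ S * M + S * M := add_le_add (prod_le f3 (bgr j)) (prod_le f4 (bgΘ j))
      _ ≤ _ := by linarith

end CompressibleEuler

end Literature.Analysis.FluidPDE
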